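/-
Copyright (c) 2026. All rights reserved.
Released under Apache 2.0 license as described in the file LICENSE.
Authors: abc-iut cell, prover seat abc-iut-w5-d014 (wave 5, gen 4).
-/
import Literature.IUT.LogVolume.UnitLogUnramifiedDyadic
import HarnessLib

/-!
# Ramified quadratic extensions of `ℚ₂` (`e = 2`, `f = 1`): `log₂(𝒪_K^×) = 𝔪³ ∪ (log₂(1 + ϖ) + 𝔪³)`

Proof-only companion (theorems, no definitions, no named facts) of abc-iut-w5-d172's `UnitLogWildDyadic.lean`
(`e(K/ℚ₂) = 2`, `f(K/ℚ₂) = 1` ⇒ `‖log₂ u‖ ≤ 2^{−1/2}`) and of abc-iut-S1's `LocalUnitLog.lean` /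
`LogSeriesEstimates.lean` / `RamificationInvariants.lean`.  `K` is a complete proper ultrametric normed
`ℚ₂`-algebra which is a field with `absRamificationIdx 2 K = 2` and `residueDegree 2 K = 1`, i.e. (abstractly) one
of the six ramified quadratic extensions `ℚ₂(√d)`, `d ∈ {−1, 3, ±2, ±10}`; `ϖ` is any element with `‖ϖ‖² = 1/2`
(a uniformizer), `r := ‖ϖ‖ = 2^{−1/2}`, `𝔪ⁿ = {‖x‖ ≤ rⁿ}`, `ℓ₁ := log₂(1 + ϖ)`.

* `exists_norm_eq_zpow`, `norm_le_pow_succ_of_norm_lt_pow` — the value group is `r^ℤ` (discreteness);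
  `norm_sub_lt_of_norm_eq` — the `𝔽₂`-cancellation `‖a‖ = ‖b‖ ≠ 0 ⇒ ‖a − b‖ < ‖b‖` (`f = 1`);
* `unitLog_mem_closedBall_cube`, `exists_unitLog_eq_of_norm_le_cube`, `closedBall_cube_subset_logUnits` —
  `log₂ : 1 + 𝔪³ ≅ 𝔪³` (`r³·2 = 2^{−1/2} < 1` is inside the Lipschitz range of abc-iut-S1's
  `logSeries_image_closedBall`), so `𝔪³ ⊆ log₂(𝒪^×)`;
* `exists_norm_sub_pow_le` — every unit is `≡ (1 + ϖ)^j (mod 𝔪³)` for some `j < 4` (`(1 + 𝔪)/(1 + 𝔪³)` is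
  cyclic of order `4` on `1 + ϖ`: `f = 1` and `‖(1 + ϖ)² − 1‖ = r²`), hence `exists_norm_unitLog_sub_nsmul_le`:
  `log₂ u ∈ j·ℓ₁ + 𝔪³`;
* **`mem_logUnits_iff`** — `z ∈ log₂(𝒪^×) ↔ ‖z‖ ≤ r³ ∨ ‖z − ℓ₁‖ ≤ r³`, i.e.
  **`log₂(𝒪_K^×) = 𝔪³ ∪ (ℓ₁ + 𝔪³)`** (`‖ℓ₁‖ ≤ r`, so `2ℓ₁ ∈ 𝔪³`).

The dichotomy «`log₂(𝒪^×)` a ball or not», its criterion `ϖ² ≡ 2 (mod 4𝒪)` and the unit stabiliser are the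
sibling file `UnitLogWildDyadicQuadraticStabilizer.lean`.  Classical local analysis (Neukirch II (5.3)–(5.5));
nothing here is disputed mathematics, no IUT statement is asserted, nothing bears on [IUTchIII] Cor. 3.12.

References: [cite: NeukirchANT1999, Ch. II Prop. (5.5)] · [cite: NeukirchANT1999, Ch. II Prop. (5.3)].
-/

noncomputable section

open Metric Set
open scoped Pointwise

namespace Literature.IUT.LogVolume

namespace WildDyadicQuadratic

open Literature.NumberTheory.GaloisRepresentations.Ultrametric

variable {K : Type*} [NontriviallyNormedField K] [instK : NormedAlgebra ℚ_[2] K]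

/-! ## 1. Norms: `r = ‖ϖ‖ = 2^{−1/2}`, the value group `r^ℤ`, and the `𝔽₂`-cancellation -/

omit instK in
/-- `‖ϖ‖² = 1/2 ⇒ 0 < ‖ϖ‖ < 1`. [cite: NeukirchANT1999, Ch. II Prop. (5.5)] -/
theorem norm_pos_and_lt_one {ϖ : K} (hϖ : ‖ϖ‖ ^ 2 = 2⁻¹) : 0 < ‖ϖ‖ ∧ ‖ϖ‖ < 1 := by
  have h0 : 0 ≤ ‖ϖ‖ := norm_nonneg ϖ
  constructor
  · rcases h0.lt_or_eq with h | h
    · exact h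
    · rw [← h] at hϖ; norm_num at hϖ
  · by_contra h
    rw [not_lt] at h
    have : (1 : ℝ) ≤ ‖ϖ‖ ^ 2 := by nlinarith
    rw [hϖ] at this; norm_num at this

/-- `‖ϖ‖² = ‖2‖`, `‖ϖ‖⁴ = ‖4‖`, `‖ϖ‖³ = ‖2ϖ‖`. [cite: NeukirchANT1999, Ch. II Prop. (5.5)] -/
theorem norm_two_eq {ϖ : K} (hϖ : ‖ϖ‖ ^ 2 = 2⁻¹) : ‖(2 : K)‖ = ‖ϖ‖ ^ 2 := by
  rw [hϖ, WildDyadic.norm_two]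

/-- `‖4‖ = ‖ϖ‖⁴`. [cite: NeukirchANT1999, Ch. II Prop. (5.5)] -/
theorem norm_four_eq {ϖ : K} (hϖ : ‖ϖ‖ ^ 2 = 2⁻¹) : ‖(4 : K)‖ = ‖ϖ‖ ^ 4 := by
  rw [show (4 : K) = 2 * 2 by norm_num, norm_mul, norm_two_eq hϖ]; ring

variable [IsUltrametricDist K]

/-- `‖ϖ‖ = 2^{−1/2}` is the norm of a uniformizer when `e(K/ℚ₂) = 2`: **every non-zero `x` has `‖x‖ = ‖ϖ‖^m`**
for some `m ∈ ℤ` (abc-iut-S1's `exists_norm_eq_rpow`). [cite: NeukirchANT1999, Ch. II Prop. (5.5)] -/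
theorem exists_norm_eq_zpow [ProperSpace K] (he : absRamificationIdx 2 K = 2) {ϖ : K} (hϖ : ‖ϖ‖ ^ 2 = 2⁻¹)
    {x : K} (hx : x ≠ 0) : ∃ m : ℤ, ‖x‖ = ‖ϖ‖ ^ m := by
  obtain ⟨m, hm⟩ := exists_norm_eq_rpow 2 K hx
  refine ⟨m, ?_⟩
  have hr : ‖ϖ‖ = (2 : ℝ) ^ (-(1 / 2 : ℝ)) := by
    have h1 : ((2 : ℝ) ^ (-(1 / 2 : ℝ))) ^ 2 = 2⁻¹ := by
      rw [← Real.rpow_natCast, ← Real.rpow_mul (by norm_num)]; norm_num [Real.rpow_neg_one]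
    exact (pow_left_inj₀ (norm_nonneg _) (by positivity) two_ne_zero).mp (by rw [hϖ, h1])
  rw [hm, he, hr, ← Real.rpow_intCast, ← Real.rpow_mul (by norm_num)]
  congr 1
  push_cast
  ring

/-- **Discreteness**: `‖x‖ < ‖ϖ‖^k ⇒ ‖x‖ ≤ ‖ϖ‖^{k+1}`. [cite: NeukirchANT1999, Ch. II Prop. (5.5)] -/
theorem norm_le_pow_succ_of_norm_lt_pow [ProperSpace K] (he : absRamificationIdx 2 K = 2) {ϖ : K}
    (hϖ : ‖ϖ‖ ^ 2 = 2⁻¹) {x : K} {k : ℕ} (h : ‖x‖ < ‖ϖ‖ ^ k) : ‖x‖ ≤ ‖ϖ‖ ^ (k + 1) := by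
  rcases eq_or_ne x 0 with rfl | hx
  · rw [norm_zero]; positivity
  obtain ⟨m, hm⟩ := exists_norm_eq_zpow he hϖ hx
  have hanti : StrictAnti fun n : ℤ => ‖ϖ‖ ^ n :=
    zpow_right_strictAnti₀ (norm_pos_and_lt_one hϖ).1 (norm_pos_and_lt_one hϖ).2
  rw [hm, ← zpow_natCast] at h ⊢
  have hkm : (k : ℤ) < m := (StrictAnti.lt_iff_gt hanti).mp h
  exact StrictAnti.antitone hanti (show ((k + 1 : ℕ) : ℤ) ≤ m by push_cast; omega)

/-- `‖x‖ < 1 ⇒ ‖x‖ ≤ ‖ϖ‖`. [cite: NeukirchANT1999, Ch. II Prop. (5.5)] -/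
theorem norm_le_of_norm_lt_one [ProperSpace K] (he : absRamificationIdx 2 K = 2) {ϖ : K} (hϖ : ‖ϖ‖ ^ 2 = 2⁻¹)
    {x : K} (h : ‖x‖ < 1) : ‖x‖ ≤ ‖ϖ‖ := by
  have h' := norm_le_pow_succ_of_norm_lt_pow he hϖ (k := 0) (by rwa [pow_zero])
  rwa [zero_add, pow_one] at h'

/-- **The `𝔽₂`-cancellation** (`f = 1`: every unit is `≡ 1`): if `‖a‖ = ‖b‖` and `b ≠ 0` then `‖a − b‖ < ‖b‖`.
[cite: NeukirchANT1999, Ch. II Prop. (5.3)] -/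
theorem norm_sub_lt_of_norm_eq [ProperSpace K] (hf : residueDegree 2 K = 1) {a b : K} (hb : b ≠ 0)
    (h : ‖a‖ = ‖b‖) : ‖a - b‖ < ‖b‖ := by
  have hb0 : 0 < ‖b‖ := norm_pos_iff.mpr hb
  have hq : ‖a / b‖ = 1 := by rw [norm_div, h, div_self hb0.ne']
  have hP : IsPrincipal (a / b) := WildDyadic.isPrincipal_of_residueDegree_eq_one hf hq
  rw [isPrincipal_iff] at hP
  have hab : a - b = -(b * (1 - a / b)) := by field_simp; ring
  rw [hab, norm_neg, norm_mul]
  calc ‖b‖ * ‖1 - a / b‖ < ‖b‖ * 1 := by gcongr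
    _ = ‖b‖ := mul_one _

variable [CompleteSpace K]

/-! ## 2. `log₂ : 1 + 𝔪³ ≅ 𝔪³` -/

/-- **`log₂(1 + 𝔪³) ⊆ 𝔪³`**: `‖1 − y‖ ≤ ‖ϖ‖³ ⇒ ‖log₂ y‖ ≤ ‖ϖ‖³` (`‖ϖ‖³·2 = 2^{−1/2} ≤ 1`: Lipschitz range).
[cite: NeukirchANT1999, Ch. II Prop. (5.5)] -/
theorem unitLog_mem_closedBall_cube {ϖ : K} (hϖ : ‖ϖ‖ ^ 2 = 2⁻¹) {y : K} (hy : ‖1 - y‖ ≤ ‖ϖ‖ ^ 3) :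
    ‖unitLog y‖ ≤ ‖ϖ‖ ^ 3 := by
  have hr := norm_pos_and_lt_one hϖ
  have hθ : ‖ϖ‖ ^ 3 * (2 : ℝ) ^ (1 / ((2 : ℝ) - 1)) ≤ 1 := by
    norm_num
    nlinarith [hr.1, hr.2, hϖ]
  have hy1 : ‖1 - y‖ < 1 := hy.trans_lt (by nlinarith [hr.1, hr.2, hϖ])
  rw [unitLog_of_isPrincipal 2 hy1]
  have h := norm_logSeries_le_norm 2 K hθ hy
  exact h.trans hy

/-- **`𝔪³ ⊆ log₂(1 + 𝔪³) ⊆ log₂(𝒪^×)`**: every `z` with `‖z‖ ≤ ‖ϖ‖³` is `log₂ y` for some `y` with `‖1 − y‖ ≤ ‖ϖ‖³`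
(abc-iut-S1's `logSeries_image_closedBall` at `ρ = 2^{−3/2}`, `ρ·2 < 1`). [cite: NeukirchANT1999, Ch. II Prop. (5.5)] -/
theorem exists_unitLog_eq_of_norm_le_cube {ϖ : K} (hϖ : ‖ϖ‖ ^ 2 = 2⁻¹) {z : K} (hz : ‖z‖ ≤ ‖ϖ‖ ^ 3) :
    ∃ y : K, ‖1 - y‖ ≤ ‖ϖ‖ ^ 3 ∧ unitLog y = z := by
  have hr := norm_pos_and_lt_one hϖ
  have hθ : ‖ϖ‖ ^ 3 * (2 : ℝ) ^ (1 / ((2 : ℝ) - 1)) < 1 := by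
    norm_num
    nlinarith [hr.1, hr.2, hϖ]
  have hmem : z ∈ {z : K | ‖z‖ ≤ ‖ϖ‖ ^ 3} := hz
  rw [← logSeries_image_closedBall 2 K hθ] at hmem
  obtain ⟨y, hy, rfl⟩ := hmem
  have hy' : ‖1 - y‖ ≤ ‖ϖ‖ ^ 3 := hy
  have hy1 : ‖1 - y‖ < 1 := hy'.trans_lt (by nlinarith [hr.1, hr.2, hϖ])
  exact ⟨y, hy', (unitLog_of_isPrincipal 2 hy1).symm ▸ rfl⟩

/-- `𝔪³ ⊆ log₂(𝒪_K^×)`. [cite: NeukirchANT1999, Ch. II Prop. (5.5)] -/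
theorem closedBall_cube_subset_logUnits {ϖ : K} (hϖ : ‖ϖ‖ ^ 2 = 2⁻¹) :
    closedBall (0 : K) (‖ϖ‖ ^ 3) ⊆ logUnits K := by
  intro z hz
  rw [mem_closedBall, dist_zero_right] at hz
  obtain ⟨y, hy, rfl⟩ := exists_unitLog_eq_of_norm_le_cube hϖ hz
  have hr := norm_pos_and_lt_one hϖ
  have hP : IsPrincipal y := hy.trans_lt (by nlinarith [hr.1, hr.2, hϖ])
  exact unitLog_mem_logUnits hP.norm_eq_one

variable [ProperSpace K]

/-! ## 3. Every unit is `≡ (1 + ϖ)^j (mod 𝔪³)`, `j < 4` -/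

omit [CompleteSpace K] [ProperSpace K] in
/-- `‖(1 + ϖ)² − 1‖ = ‖ϖ‖²` (`(1 + ϖ)² − 1 = ϖ² + 2ϖ`, `‖2ϖ‖ = ‖ϖ‖³ < ‖ϖ‖²`). [cite: NeukirchANT1999, Ch. II Prop. (5.3)] -/
theorem norm_one_add_sq_sub_one {ϖ : K} (hϖ : ‖ϖ‖ ^ 2 = 2⁻¹) : ‖(1 + ϖ) ^ 2 - 1‖ = ‖ϖ‖ ^ 2 := by
  have hr := norm_pos_and_lt_one hϖ
  have h2 : ‖2 * ϖ‖ = ‖ϖ‖ ^ 3 := by rw [norm_mul, norm_two_eq hϖ]; ring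
  have hne : ‖ϖ ^ 2‖ ≠ ‖2 * ϖ‖ := by
    rw [norm_pow, h2]
    exact (pow_lt_pow_right_of_lt_one₀ hr.1 hr.2 (by norm_num : 2 < 3)).ne'
  rw [show (1 + ϖ) ^ 2 - 1 = ϖ ^ 2 + 2 * ϖ by ring, IsUltrametricDist.norm_add_eq_max_of_norm_ne_norm hne,
    norm_pow, h2, max_eq_left]
  exact (pow_lt_pow_right_of_lt_one₀ hr.1 hr.2 (by norm_num : 2 < 3)).le

omit [CompleteSpace K] in
/-- Level `2`: if `‖u − 1‖ ≤ ‖ϖ‖²` then `u ≡ 1` or `u ≡ (1 + ϖ)² (mod 𝔪³)`. [cite: NeukirchANT1999, Ch. II Prop. (5.3)] -/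
theorem norm_sub_le_cube_or_of_norm_sub_one_le_sq (he : absRamificationIdx 2 K = 2) (hf : residueDegree 2 K = 1)
    {ϖ : K} (hϖ : ‖ϖ‖ ^ 2 = 2⁻¹) {u : K} (hu : ‖u - 1‖ ≤ ‖ϖ‖ ^ 2) :
    ‖u - 1‖ ≤ ‖ϖ‖ ^ 3 ∨ ‖u - (1 + ϖ) ^ 2‖ ≤ ‖ϖ‖ ^ 3 := by
  rcases hu.lt_or_eq with hlt | heq
  · exact Or.inl (norm_le_pow_succ_of_norm_lt_pow he hϖ hlt)
  · right
    have hb : (1 + ϖ) ^ 2 - 1 ≠ 0 := by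
      rw [← norm_pos_iff, norm_one_add_sq_sub_one hϖ]; exact pow_pos (norm_pos_and_lt_one hϖ).1 2
    have h := norm_sub_lt_of_norm_eq hf hb (by rw [heq, norm_one_add_sq_sub_one hϖ])
    rw [norm_one_add_sq_sub_one hϖ, show u - 1 - ((1 + ϖ) ^ 2 - 1) = u - (1 + ϖ) ^ 2 by ring] at h
    exact norm_le_pow_succ_of_norm_lt_pow he hϖ h

omit [CompleteSpace K] in
/-- **Every unit `u` is `≡ (1 + ϖ)^j (mod 𝔪³)` for some `j < 4`** (`f = 1`: `u ≡ 1 (mod 𝔪)`; at each level the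
`𝔽₂`-cancellation against `(1 + ϖ)^j − 1`). [cite: NeukirchANT1999, Ch. II Prop. (5.3)] -/
theorem exists_norm_sub_pow_le (he : absRamificationIdx 2 K = 2) (hf : residueDegree 2 K = 1) {ϖ : K}
    (hϖ : ‖ϖ‖ ^ 2 = 2⁻¹) {u : K} (hu : ‖u‖ = 1) : ∃ j : ℕ, j < 4 ∧ ‖u - (1 + ϖ) ^ j‖ ≤ ‖ϖ‖ ^ 3 := by
  have hr := norm_pos_and_lt_one hϖ
  have hP : ‖u - 1‖ < 1 := by
    have h := WildDyadic.isPrincipal_of_residueDegree_eq_one hf hu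
    rw [isPrincipal_iff, norm_sub_rev] at h; exact h
  have h1 : ‖u - 1‖ ≤ ‖ϖ‖ := norm_le_of_norm_lt_one he hϖ hP
  rcases h1.lt_or_eq with hlt | heq
  · -- level `≥ 2`
    have h2 : ‖u - 1‖ ≤ ‖ϖ‖ ^ 2 := norm_le_pow_succ_of_norm_lt_pow he hϖ (k := 1) (by rwa [pow_one])
    rcases norm_sub_le_cube_or_of_norm_sub_one_le_sq he hf hϖ h2 with h0 | h0
    · exact ⟨0, by norm_num, by rwa [pow_zero]⟩
    · exact ⟨2, by norm_num, h0⟩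
  · -- level `1`: divide by `g = 1 + ϖ`
    have hϖ0 : ϖ ≠ 0 := norm_pos_iff.mp hr.1
    have hug : ‖u - (1 + ϖ)‖ ≤ ‖ϖ‖ ^ 2 := by
      have h := norm_sub_lt_of_norm_eq hf hϖ0 heq
      rw [show u - 1 - ϖ = u - (1 + ϖ) by ring] at h
      exact norm_le_pow_succ_of_norm_lt_pow he hϖ (k := 1) (by rwa [pow_one])
    have hg1 : ‖(1 + ϖ : K)‖ = 1 := by
      rw [IsUltrametricDist.norm_add_eq_max_of_norm_ne_norm (by rw [norm_one]; exact hr.2.ne'), norm_one,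
        max_eq_left hr.2.le]
    have hg0 : (1 + ϖ : K) ≠ 0 := norm_pos_iff.mp (by rw [hg1]; exact one_pos)
    set u' : K := u / (1 + ϖ) with hu'
    have hu'1 : ‖u' - 1‖ ≤ ‖ϖ‖ ^ 2 := by
      rw [hu', show u / (1 + ϖ) - 1 = (u - (1 + ϖ)) / (1 + ϖ) by field_simp, norm_div, hg1, div_one]
      exact hug
    have hback : ∀ (w : K), ‖u' - w‖ = ‖u - (1 + ϖ) * w‖ := fun w => by
      rw [hu', show u / (1 + ϖ) - w = (u - (1 + ϖ) * w) / (1 + ϖ) by field_simp, norm_div, hg1, div_one]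
    rcases norm_sub_le_cube_or_of_norm_sub_one_le_sq he hf hϖ hu'1 with h0 | h0
    · refine ⟨1, by norm_num, ?_⟩
      rw [pow_one, ← mul_one (1 + ϖ), ← hback]; exact h0
    · refine ⟨3, by norm_num, ?_⟩
      rw [show (1 + ϖ) ^ 3 = (1 + ϖ) * (1 + ϖ) ^ 2 by ring, ← hback]; exact h0

/-- … hence **`log₂ u ∈ j·ℓ₁ + 𝔪³`**, `ℓ₁ = log₂(1 + ϖ)`, for some `j < 4`. [cite: NeukirchANT1999, Ch. II Prop. (5.5)] -/
theorem exists_norm_unitLog_sub_nsmul_le (he : absRamificationIdx 2 K = 2) (hf : residueDegree 2 K = 1) {ϖ : K}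
    (hϖ : ‖ϖ‖ ^ 2 = 2⁻¹) {u : K} (hu : ‖u‖ = 1) :
    ∃ j : ℕ, j < 4 ∧ ‖unitLog u - j * unitLog (1 + ϖ)‖ ≤ ‖ϖ‖ ^ 3 := by
  have hr := norm_pos_and_lt_one hϖ
  obtain ⟨j, hj, hju⟩ := exists_norm_sub_pow_le he hf hϖ hu
  have hg1 : ‖(1 + ϖ : K)‖ = 1 := by
    rw [IsUltrametricDist.norm_add_eq_max_of_norm_ne_norm (by rw [norm_one]; exact hr.2.ne'), norm_one,
      max_eq_left hr.2.le]
  have hgj1 : ‖((1 + ϖ) ^ j : K)‖ = 1 := by rw [norm_pow, hg1, one_pow]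
  have hgj0 : ((1 + ϖ) ^ j : K) ≠ 0 := norm_pos_iff.mp (by rw [hgj1]; exact one_pos)
  -- `y := u · g^{-j} ∈ 1 + 𝔪³`
  set y : K := u / (1 + ϖ) ^ j with hy
  have hy1 : ‖1 - y‖ ≤ ‖ϖ‖ ^ 3 := by
    rw [hy, show 1 - u / (1 + ϖ) ^ j = ((1 + ϖ) ^ j - u) / (1 + ϖ) ^ j by field_simp, norm_div, hgj1, div_one,
      norm_sub_rev]
    exact hju
  have hyn : ‖y‖ = 1 := by rw [hy, norm_div, hu, hgj1, div_one]
  refine ⟨j, hj, ?_⟩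
  have hsplit : unitLog u = j * unitLog (1 + ϖ) + unitLog y := by
    rw [show u = (1 + ϖ) ^ j * y by rw [hy, mul_div_cancel₀ _ hgj0], unitLog_mul 2 hgj1 hyn,
      unitLog_pow 2 hg1]
  rw [hsplit, add_sub_cancel_left]
  exact unitLog_mem_closedBall_cube hϖ hy1

/-! ## 4. `log₂(𝒪_K^×) = 𝔪³ ∪ (ℓ₁ + 𝔪³)` -/

/-- `‖ℓ₁‖ ≤ ‖ϖ‖` and `‖2ℓ₁‖ ≤ ‖ϖ‖³` (abc-iut-w5-d172's bound `‖log₂ u‖ ≤ 2^{−1/2}` at `e = 2`, `f = 1`).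
[cite: NeukirchANT1999, Ch. II Prop. (5.5)] -/
theorem norm_unitLog_le (he : absRamificationIdx 2 K = 2) (hf : residueDegree 2 K = 1) {ϖ : K}
    (hϖ : ‖ϖ‖ ^ 2 = 2⁻¹) (u : K) : ‖unitLog u‖ ≤ ‖ϖ‖ := by
  have h := WildDyadic.norm_unitLog_le_of_absRamificationIdx_eq_two_of_residueDegree_eq_one he hf u
  have hr : ‖ϖ‖ = (2 : ℝ) ^ (-(1 / 2 : ℝ)) := by
    have h1 : ((2 : ℝ) ^ (-(1 / 2 : ℝ))) ^ 2 = 2⁻¹ := by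
      rw [← Real.rpow_natCast, ← Real.rpow_mul (by norm_num)]; norm_num [Real.rpow_neg_one]
    exact (pow_left_inj₀ (norm_nonneg _) (by positivity) two_ne_zero).mp (by rw [hϖ, h1])
  rwa [← hr] at h

/-- **`log₂(𝒪_K^×) = 𝔪³ ∪ (log₂(1 + ϖ) + 𝔪³)`** for a ramified quadratic `K/ℚ₂`:
`z ∈ log₂(𝒪^×) ↔ ‖z‖ ≤ ‖ϖ‖³ ∨ ‖z − log₂(1 + ϖ)‖ ≤ ‖ϖ‖³`. [cite: NeukirchANT1999, Ch. II Prop. (5.5)] -/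
theorem mem_logUnits_iff (he : absRamificationIdx 2 K = 2) (hf : residueDegree 2 K = 1) {ϖ : K}
    (hϖ : ‖ϖ‖ ^ 2 = 2⁻¹) (z : K) :
    z ∈ logUnits K ↔ ‖z‖ ≤ ‖ϖ‖ ^ 3 ∨ ‖z - unitLog (1 + ϖ)‖ ≤ ‖ϖ‖ ^ 3 := by
  have hr := norm_pos_and_lt_one hϖ
  have h2ℓ : ‖2 * unitLog (1 + ϖ)‖ ≤ ‖ϖ‖ ^ 3 := by
    rw [norm_mul, norm_two_eq hϖ, pow_succ]
    exact mul_le_mul_of_nonneg_left (norm_unitLog_le he hf hϖ _) (by positivity)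
  have hg1 : ‖(1 + ϖ : K)‖ = 1 := by
    rw [IsUltrametricDist.norm_add_eq_max_of_norm_ne_norm (by rw [norm_one]; exact hr.2.ne'), norm_one,
      max_eq_left hr.2.le]
  constructor
  · rintro ⟨u, hu, rfl⟩
    rw [mem_setOf_eq] at hu
    obtain ⟨j, hj, hju⟩ := exists_norm_unitLog_sub_nsmul_le he hf hϖ hu
    interval_cases j
    · left; simpa using hju
    · right; simpa using hju
    · left
      have : unitLog u = (unitLog u - (2 : ℕ) * unitLog (1 + ϖ)) + 2 * unitLog (1 + ϖ) := by push_cast; ring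
      rw [this]
      exact (IsUltrametricDist.norm_add_le_max _ _).trans (max_le hju h2ℓ)
    · right
      have : unitLog u - unitLog (1 + ϖ) = (unitLog u - (3 : ℕ) * unitLog (1 + ϖ)) + 2 * unitLog (1 + ϖ) := by
        push_cast; ring
      rw [this]
      exact (IsUltrametricDist.norm_add_le_max _ _).trans (max_le hju h2ℓ)
  · rintro (hz | hz)
    · exact closedBall_cube_subset_logUnits hϖ (by rwa [mem_closedBall, dist_zero_right])
    · obtain ⟨y, hy, hyz⟩ := exists_unitLog_eq_of_norm_le_cube hϖ hz
      have hyn : ‖y‖ = 1 := (IsPrincipal.norm_eq_one (hy.trans_lt (by nlinarith [hr.1, hr.2, hϖ])))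
      refine ⟨(1 + ϖ) * y, by rw [mem_setOf_eq, norm_mul, hg1, hyn, one_mul], ?_⟩
      rw [unitLog_mul 2 hg1 hyn, hyz, add_sub_cancel]

end WildDyadicQuadratic

end Literature.IUT.LogVolume

end
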